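import Literature.Barriers.AtomisticToContinuum.AnticontinuumLocalizationProofs
import Literature.Analysis.ODE.LinearGrowth
import Mathlib.MeasureTheory.Integral.Pi
import Mathlib.Analysis.SpecialFunctions.Gaussian.GaussianIntegral
import HarnessLib

/-!
# The rotor chain is well posed: the flow exists (and is unique), the Gibbs state is a probability measure

`Literature/Barriers/AtomisticToContinuum/` — non-vacuity companion of
`AnticontinuumLocalization.lean` (De Roeck–Huveneers 2015) and `AnticontinuumLocalizationProofs.lean`.
The named facts `DeRoeckHuveneers2015_thm1/thm2/thm4` quantify UNIVERSALLY over flow maps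
`Φ` with `RotorChain.IsFlow N ε γ Φ` and take Gibbs averages against `RotorChain.gibbsMeasure N T ε γ`
("`Z(T)` is a normalization factor such that this measure is a probability measure", §2.2). This
file PROVES that both are the intended objects for ALL parameters:

* `RotorChain.rotorFlow N ε γ` — THE flow ("we denote the Hamiltonian flow by `(X^t_ε(q, ω))_{t ≥ 0}`",
  §2.1): global integral curves exist because the field `(ω, -ε∇V(q))` is globally Lipschitz and
  vanishes at the origin (linear growth; `Literature.Analysis.ODE.exists_solution_of_linearGrowth`),
  `RotorChain.isFlow_rotorFlow : IsFlow N ε γ (rotorFlow N ε γ)` (Hamilton's equations, `X^0 = id`,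
  joint continuity from Grönwall's `‖X^t z - X^t z'‖ ≤ e^{K|t|}‖z - z'‖`,
  `RotorChain.dist_rotorFlow_le`, uniformly on bounded times), and
  `RotorChain.IsFlow.eq_rotorFlow : IsFlow N ε γ Φ → Φ = rotorFlow N ε γ` (uniqueness) — so
  "for every flow map" in the facts means "for the flow";
* `RotorChain.isProbabilityMeasure_gibbsMeasure : 0 < T → IsProbabilityMeasure (gibbsMeasure N T ε γ)`
  for every `N, ε, γ`: the weight `e^{-H/T}` is integrable on the fundamental domain
  `[0, 2π)^N × ℝ^N` (`integrableOn_gibbsWeight`: bounded potentials `|V_x| ≤ 2|γ| + 2`, Gaussian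
  momenta, `Integrable.fintype_prod`/`integrable_exp_neg_mul_sq`) and the partition function is
  positive (`partitionFunction_pos`: the domain contains a nonempty open set), so the normalised
  restricted measure of the main file has total mass `Z⁻¹ · Z = 1`.

Everything is proved; no definitions beyond `rotorFlow` (a `Classical.choose` of the integral
curve, pinned down by `IsFlow.eq_rotorFlow`) and the angle box `angleBox N = [0, 2π)^N`.

## References

* W. De Roeck, F. Huveneers, CPAM 68 (2015), arXiv:1305.5127, §2.1 (the flow `X^t_ε`), §2.2 (the
  Gibbs state). [DeRoeckHuveneers2015]
* P. Hartman, *Ordinary Differential Equations* (SIAM 2002), Ch. IV Lemma 1.1 (global existence under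
  linear growth; via `Literature/Analysis/ODE/LinearGrowth.lean`).
-/

noncomputable section

open MeasureTheory Filter Set Metric
open scoped ContDiff ENNReal Topology NNReal

namespace Literature.Barriers.AtomisticToContinuum.HeatConduction.RotorChain

open Literature.MathematicalPhysics.KineticTheory.HeatConduction

variable {N : ℕ} {ε γ : ℝ} {Φ : ℝ → PhaseSpace N → PhaseSpace N}

/-! ## Existence of the flow (non-vacuity of `IsFlow`) -/

section Existence

/-- The field vanishes at the origin. [folklore] -/
theorem field_zero (N : ℕ) (ε γ : ℝ) : field N ε γ 0 = 0 := by
  ext x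
  · simp [field]
  · simp [field, force, forceCore]

/-- Linear growth: `‖X_H(z)‖ ≤ K ‖z‖` with `K` the Lipschitz constant. [folklore] -/
theorem norm_field_le_mul (ε γ : ℝ) (z : PhaseSpace N) :
    ‖field N ε γ z‖ ≤ fieldLipschitz ε γ * ‖z‖ := by
  have := (lipschitzWith_field N ε γ).norm_sub_le z 0
  rwa [field_zero, sub_zero, sub_zero] at this

/-- Global integral curves of the rotor field through every point (linear growth). [folklore] -/
theorem exists_orbit (N : ℕ) (ε γ : ℝ) (z : PhaseSpace N) :
    ∃ α : ℝ → PhaseSpace N, α 0 = z ∧ ∀ t, HasDerivAt α (field N ε γ (α t)) t :=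
  Literature.Analysis.ODE.exists_solution_of_linearGrowth (v := fun _ => field N ε γ)
    (fun _ => ⟨fieldLipschitz ε γ, fun _ _ => ⟨lipschitzWith_field N ε γ, norm_field_le_mul ε γ⟩⟩)
    (fun _ => continuous_const) z

/-- THE flow of the rotor chain: `rotorFlow N ε γ t z` is the value at time `t` of the integral
curve through `z`. [cite: DeRoeckHuveneers2015, §2.1 ("we denote the Hamiltonian flow by `(X^t_ε(q, ω))`")] -/
def rotorFlow (N : ℕ) (ε γ : ℝ) (t : ℝ) (z : PhaseSpace N) : PhaseSpace N :=
  Classical.choose (exists_orbit N ε γ z) t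

/-- `X^0 = id`. [folklore] -/
theorem rotorFlow_zero (N : ℕ) (ε γ : ℝ) (z : PhaseSpace N) : rotorFlow N ε γ 0 z = z :=
  (Classical.choose_spec (exists_orbit N ε γ z)).1

/-- The orbits of `rotorFlow` are integral curves. [folklore] -/
theorem hasDerivAt_rotorFlow (N : ℕ) (ε γ : ℝ) (z : PhaseSpace N) (t : ℝ) :
    HasDerivAt (fun s => rotorFlow N ε γ s z) (field N ε γ (rotorFlow N ε γ t z)) t :=
  (Classical.choose_spec (exists_orbit N ε γ z)).2 t

/-- Orbits are continuous in time. [folklore] -/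
theorem continuous_rotorFlow_time (N : ℕ) (ε γ : ℝ) (z : PhaseSpace N) :
    Continuous fun t => rotorFlow N ε γ t z :=
  continuous_iff_continuousAt.2 fun t => (hasDerivAt_rotorFlow N ε γ z t).continuousAt

/-- **Grönwall**: `‖X^t z - X^t z'‖ ≤ e^{K|t|} ‖z - z'‖`. [folklore] -/
theorem dist_rotorFlow_le (N : ℕ) (ε γ : ℝ) (t : ℝ) (z z' : PhaseSpace N) :
    dist (rotorFlow N ε γ t z) (rotorFlow N ε γ t z') ≤
      dist z z' * Real.exp (fieldLipschitz ε γ * |t|) := by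
  rcases le_or_gt 0 t with ht | ht
  · have h := dist_le_of_trajectories_ODE (v := fun _ => field N ε γ) (K := fieldLipschitz ε γ)
      (f := fun s => rotorFlow N ε γ s z) (g := fun s => rotorFlow N ε γ s z') (a := 0) (b := t)
      (δ := dist z z')
      (fun _ => lipschitzWith_field N ε γ) (continuous_rotorFlow_time N ε γ z).continuousOn
      (fun s _ => (hasDerivAt_rotorFlow N ε γ z s).hasDerivWithinAt)
      (continuous_rotorFlow_time N ε γ z').continuousOn
      (fun s _ => (hasDerivAt_rotorFlow N ε γ z' s).hasDerivWithinAt)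
      (by rw [rotorFlow_zero, rotorFlow_zero]) t ⟨ht, le_rfl⟩
    rw [abs_of_nonneg ht]
    simpa using h
  · -- time reversal: `s ↦ X^{-s}` solves the ODE with the field `-X_H`
    have hrev : ∀ w : PhaseSpace N, ∀ s, HasDerivAt (fun s => rotorFlow N ε γ (-s) w)
        (-(field N ε γ (rotorFlow N ε γ (-s) w))) s := fun w s => by
      have := (hasDerivAt_rotorFlow N ε γ w (-s)).scomp s (hasDerivAt_neg s)
      simpa [Function.comp_def] using this
    have h := dist_le_of_trajectories_ODE (v := fun _ w => -(field N ε γ w)) (K := fieldLipschitz ε γ)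
      (f := fun s => rotorFlow N ε γ (-s) z) (g := fun s => rotorFlow N ε γ (-s) z') (a := 0) (b := -t)
      (δ := dist z z')
      (fun _ => (lipschitzWith_field N ε γ).neg)
      ((continuous_rotorFlow_time N ε γ z).comp continuous_neg).continuousOn
      (fun s _ => (hrev z s).hasDerivWithinAt)
      ((continuous_rotorFlow_time N ε γ z').comp continuous_neg).continuousOn
      (fun s _ => (hrev z' s).hasDerivWithinAt)
      (by simp only [neg_zero, rotorFlow_zero]; exact le_rfl) (-t) ⟨by linarith, le_rfl⟩
    simp only [neg_neg, sub_zero] at h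
    rwa [abs_of_neg ht]

/-- **The rotor chain has a (unique) flow**: `rotorFlow N ε γ` satisfies `IsFlow` — Hamilton's
equations, `X^0 = id`, and joint continuity (Grönwall in the initial condition, uniformly on
bounded times). Non-vacuity of the universal quantification over flow maps in
`DeRoeckHuveneers2015_thm2/thm4`. [cite: DeRoeckHuveneers2015, §2.1] -/
theorem isFlow_rotorFlow (N : ℕ) (ε γ : ℝ) : IsFlow N ε γ (rotorFlow N ε γ) := by
  refine ⟨?_, rotorFlow_zero N ε γ, fun z x t => ?_⟩
  · -- joint continuity on `(-T, T) × phase space` for every `T`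
    have hT : ∀ T : ℝ, ContinuousOn (fun p : ℝ × PhaseSpace N => rotorFlow N ε γ p.1 p.2)
        (Ioo (-T) T ×ˢ univ) := fun T => by
      set K' : NNReal := ⟨Real.exp (fieldLipschitz ε γ * T), (Real.exp_pos _).le⟩ with hK'def
      have hK' : (K' : ℝ) = Real.exp (fieldLipschitz ε γ * T) := rfl
      refine continuousOn_prod_of_continuousOn_lipschitzOnWith' (fun p : ℝ × PhaseSpace N =>
        rotorFlow N ε γ p.1 p.2) K'
        (fun a ha => ?_) (fun z _ => (continuous_rotorFlow_time N ε γ z).continuousOn)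
      refine LipschitzOnWith.of_dist_le_mul fun z _ z' _ => ?_
      calc dist (rotorFlow N ε γ a z) (rotorFlow N ε γ a z')
          ≤ dist z z' * Real.exp (fieldLipschitz ε γ * |a|) := dist_rotorFlow_le N ε γ a z z'
        _ ≤ dist z z' * Real.exp (fieldLipschitz ε γ * T) := by
            refine mul_le_mul_of_nonneg_left (Real.exp_le_exp.2 ?_) dist_nonneg
            exact mul_le_mul_of_nonneg_left (abs_le.2 ⟨ha.1.le, ha.2.le⟩) (NNReal.coe_nonneg _)
        _ = K' * dist z z' := by rw [hK', mul_comm]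
    refine continuous_iff_continuousAt.2 fun p => ?_
    have hp : p ∈ Ioo (-(|p.1| + 1)) (|p.1| + 1) ×ˢ (univ : Set (PhaseSpace N)) :=
      ⟨⟨by linarith [neg_abs_le p.1], by linarith [le_abs_self p.1]⟩, mem_univ _⟩
    exact (hT (|p.1| + 1)).continuousAt ((isOpen_Ioo.prod isOpen_univ).mem_nhds hp)
  · have h := hasDerivAt_rotorFlow N ε γ z t
    refine ⟨(hasDerivAt_pi.1 h.fst) x, ?_⟩
    have h2 := (hasDerivAt_pi.1 h.snd) x
    rw [partialQ_hamiltonian, neg_neg]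
    exact h2

/-- Every flow map is THE flow. [folklore] -/
theorem IsFlow.eq_rotorFlow (hΦ : IsFlow N ε γ Φ) : Φ = rotorFlow N ε γ := by
  funext t z
  have h := (isFlow_rotorFlow N ε γ).eq_orbit (f := fun s => Φ s z) (hΦ.hasDerivAt z)
  have := congrFun h t
  simp only [hΦ.map_zero] at this
  exact this

end Existence

/-! ## The Gibbs state is a probability measure -/

section Normalisation

/-- The site potentials are bounded: `|V_x(q)| ≤ 2|γ| + 2`. [folklore] -/
theorem abs_sitePotential_le (γ : ℝ) (q : Fin N → ℝ) (x : Fin N) :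
    |sitePotential N γ q x| ≤ 2 * |γ| + 2 := by
  unfold sitePotential
  have h1 : |γ * (1 - Real.cos (q x))| ≤ 2 * |γ| := by
    rw [abs_mul]
    have : |1 - Real.cos (q x)| ≤ 2 := by
      rw [abs_le]; constructor <;> linarith [Real.cos_le_one (q x), Real.neg_one_le_cos (q x)]
    nlinarith [abs_nonneg γ]
  have h2 : |∑ y : Fin N, (if y.val = x.val + 1 then (1 - Real.cos (q x - q y)) else 0)| ≤ 2 :=
    abs_sum_ite_succ_le (N := N) zero_le_two (fun y => by
      rw [abs_le]; constructor <;> linarith [Real.cos_le_one (q x - q y), Real.neg_one_le_cos (q x - q y)]) x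
  calc _ ≤ |γ * (1 - Real.cos (q x))| + |∑ y : Fin N, (if y.val = x.val + 1 then (1 - Real.cos (q x - q y)) else 0)| :=
        abs_add_le _ _
    _ ≤ 2 * |γ| + 2 := add_le_add h1 h2

/-- Lower bound of the Hamiltonian by the kinetic energy: `H ≥ ∑ ω_x²/2 - N|ε|(2|γ|+2)`.
[folklore] -/
theorem kinetic_sub_le_hamiltonian (ε γ : ℝ) (z : PhaseSpace N) :
    (∑ x : Fin N, z.2 x ^ 2 / 2) - N * (|ε| * (2 * |γ| + 2)) ≤ hamiltonian N ε γ z := by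
  unfold hamiltonian siteEnergy
  rw [Finset.sum_add_distrib]
  have h : ∀ x : Fin N, -(|ε| * (2 * |γ| + 2)) ≤ ε * sitePotential N γ z.1 x := fun x => by
    have := abs_sitePotential_le γ z.1 x
    have h' : |ε * sitePotential N γ z.1 x| ≤ |ε| * (2 * |γ| + 2) := by
      rw [abs_mul]; exact mul_le_mul_of_nonneg_left this (abs_nonneg ε)
    linarith [neg_abs_le (ε * sitePotential N γ z.1 x)]
  have := Finset.sum_le_sum fun x (_ : x ∈ Finset.univ) => h x
  simp only [Finset.sum_const, Finset.card_univ, Fintype.card_fin, nsmul_eq_mul] at this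
  linarith

/-- Domination of the Gibbs weight by a Gaussian in the momenta:
`e^{-H/T} ≤ e^{N|ε|(2|γ|+2)/T} ∏_x e^{-ω_x²/(2T)}` (`T > 0`). [folklore] -/
theorem gibbsWeight_le {T : ℝ} (hT : 0 < T) (ε γ : ℝ) (z : PhaseSpace N) :
    gibbsWeight N T ε γ z ≤ Real.exp (N * (|ε| * (2 * |γ| + 2)) / T) *
      ∏ x : Fin N, Real.exp (-(1 / (2 * T)) * z.2 x ^ 2) := by
  unfold gibbsWeight
  rw [← Real.exp_sum, ← Real.exp_add]
  refine Real.exp_le_exp.2 ?_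
  have h := kinetic_sub_le_hamiltonian ε γ z
  have e : ∑ x : Fin N, -(1 / (2 * T)) * z.2 x ^ 2 = -(∑ x : Fin N, z.2 x ^ 2 / 2) / T := by
    rw [neg_div, Finset.sum_div, ← Finset.sum_neg_distrib]
    refine Finset.sum_congr rfl fun x _ => ?_
    field_simp
  rw [e, ← add_div]
  exact div_le_div_of_nonneg_right (by linarith [h]) hT.le

/-- The box `[0, 2π)^N` of angles. [folklore] -/
def angleBox (N : ℕ) : Set (Fin N → ℝ) := Set.pi univ fun _ => Ico 0 (2 * Real.pi)

/-- The fundamental domain is the preimage of the angle box. [folklore] -/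
theorem domain_eq_preimage_angleBox (N : ℕ) : domain N = Prod.fst ⁻¹' angleBox N := by
  ext z; simp [domain, angleBox, Set.mem_pi]

/-- The angle box is measurable. [folklore] -/
theorem measurableSet_angleBox (N : ℕ) : MeasurableSet (angleBox N) :=
  MeasurableSet.univ_pi fun _ => measurableSet_Ico

/-- The angle box has finite volume `(2π)^N`. [folklore] -/
theorem volume_angleBox_ne_top (N : ℕ) : volume (angleBox N) ≠ ⊤ := by
  rw [angleBox, volume_pi, Measure.pi_pi]
  exact ENNReal.prod_ne_top fun _ _ => by rw [Real.volume_Ico]; exact ENNReal.ofReal_ne_top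

/-- **The Gibbs weight is integrable on the fundamental domain** (`T > 0`; bounded potentials,
Gaussian momenta). [folklore] -/
theorem integrableOn_gibbsWeight {T : ℝ} (hT : 0 < T) (ε γ : ℝ) :
    IntegrableOn (gibbsWeight N T ε γ) (domain N) volume := by
  set c := Real.exp (N * (|ε| * (2 * |γ| + 2)) / T) with hc
  -- the dominating function `1_box(q) · c ∏ e^{-ω²/2T}`
  set g : PhaseSpace N → ℝ := fun z => (angleBox N).indicator (fun _ => (1 : ℝ)) z.1 *
    (c * ∏ x : Fin N, Real.exp (-(1 / (2 * T)) * z.2 x ^ 2)) with hg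
  have hg1 : Integrable ((angleBox N).indicator fun _ => (1 : ℝ)) (volume : Measure (Fin N → ℝ)) :=
    (integrable_indicator_iff (measurableSet_angleBox N)).2 (integrableOn_const (volume_angleBox_ne_top N))
  have hg2 : Integrable (fun p : Fin N → ℝ => c * ∏ x : Fin N, Real.exp (-(1 / (2 * T)) * p x ^ 2)) volume := by
    refine Integrable.const_mul ?_ c
    rw [volume_pi]
    exact Integrable.fintype_prod (f := fun (_ : Fin N) (s : ℝ) => Real.exp (-(1 / (2 * T)) * s ^ 2))
      fun _ => integrable_exp_neg_mul_sq (by positivity)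
  have hgi : Integrable g (volume : Measure (PhaseSpace N)) := hg1.mul_prod hg2
  rw [← integrable_indicator_iff (measurableSet_domain N)]
  refine hgi.mono' ?_ (ae_of_all _ fun z => ?_)
  · exact (((contDiff_hamiltonian (N := N) ε γ (n := 0)).continuous.neg.div_const T).rexp.measurable.indicator
      (measurableSet_domain N)).aestronglyMeasurable
  · by_cases hz : z ∈ domain N
    · rw [Set.indicator_of_mem hz, Real.norm_eq_abs, abs_of_pos (show 0 < gibbsWeight N T ε γ z from Real.exp_pos _)]
      have hz1 : z.1 ∈ angleBox N := by rw [domain_eq_preimage_angleBox] at hz; exact hz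
      simp only [hg, Set.indicator_of_mem hz1, one_mul]
      exact gibbsWeight_le hT ε γ z
    · rw [Set.indicator_of_notMem hz, norm_zero]
      simp only [hg]
      refine mul_nonneg (Set.indicator_nonneg (fun _ _ => zero_le_one) _) ?_
      exact mul_nonneg (Real.exp_pos _).le (Finset.prod_nonneg fun _ _ => (Real.exp_pos _).le)

/-- **The partition function is positive** (`T > 0`). [folklore] -/
theorem partitionFunction_pos {T : ℝ} (hT : 0 < T) (ε γ : ℝ) : 0 < partitionFunction N T ε γ := by
  haveI := isAddHaarMeasure_volume_phaseSpace N
  unfold partitionFunction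
  rw [integral_pos_iff_support_of_nonneg (f := gibbsWeight N T ε γ) (fun z => (Real.exp_pos _).le)
    (integrableOn_gibbsWeight hT ε γ)]
  have hsupp : Function.support (gibbsWeight N T ε γ) = univ := by
    ext z; simp [gibbsWeight, (Real.exp_pos _).ne']
  rw [hsupp, Measure.restrict_apply_univ]
  -- the domain contains a nonempty open set
  set U : Set (PhaseSpace N) := {z | ∀ x : Fin N, z.1 x ∈ Ioo 0 (2 * Real.pi)}
  have hU : IsOpen U := by
    have : U = ⋂ x : Fin N, (fun z : PhaseSpace N => z.1 x) ⁻¹' Ioo 0 (2 * Real.pi) := by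
      ext z; simp [U]
    rw [this]
    exact isOpen_iInter_of_finite fun x =>
      isOpen_Ioo.preimage ((continuous_apply x).comp continuous_fst)
  have hUne : U.Nonempty := ⟨(fun _ => Real.pi, 0), fun x => ⟨Real.pi_pos, by linarith [Real.pi_pos]⟩⟩
  have hUD : U ⊆ domain N := fun z hz x => ⟨(hz x).1.le, (hz x).2⟩
  exact (hU.measure_pos volume hUne).trans_le (measure_mono hUD)

/-- **The Gibbs state of the rotor chain is a probability measure** (`T > 0`, any `ε, γ`):
non-vacuity of the Gibbs averages in `DeRoeckHuveneers2015_thm1/thm2/thm4`.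
[cite: DeRoeckHuveneers2015, §2.2 ("`Z(T)` is a normalization factor such that this measure is a probability measure")] -/
theorem isProbabilityMeasure_gibbsMeasure {T : ℝ} (hT : 0 < T) (N : ℕ) (ε γ : ℝ) :
    IsProbabilityMeasure (gibbsMeasure N T ε γ) := by
  constructor
  rw [gibbsMeasure_eq, Measure.smul_apply, Measure.restrict_apply MeasurableSet.univ, univ_inter,
    smul_eq_mul]
  have hZ : (liftedGibbs N T ε γ) (domain N) = ENNReal.ofReal (partitionFunction N T ε γ) := by
    unfold liftedGibbs gibbsDensity partitionFunction
    rw [withDensity_apply _ (measurableSet_domain N),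
      ofReal_integral_eq_lintegral_ofReal (integrableOn_gibbsWeight hT ε γ)
        (ae_of_all _ fun z => (Real.exp_pos _).le)]
  rw [hZ, ENNReal.inv_mul_cancel (ENNReal.ofReal_pos.2 (partitionFunction_pos hT ε γ)).ne'
    ENNReal.ofReal_ne_top]

end Normalisation

end Literature.Barriers.AtomisticToContinuum.HeatConduction.RotorChain

end
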